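import Summits.ResolutionOfSingularities.ResolutionOfSingularities.Theorems.WildConesCampaignW46HypersurfacesCharTwoNullPolar
import Summits.ResolutionOfSingularities.ResolutionOfSingularities.Theorems.WildConesCampaignW46HypersurfacesCharTwoCubicPolarization
import Summits.ResolutionOfSingularities.ResolutionOfSingularities.Theorems.WildConesCampaignW46HypersurfacesCharTwoFreePoints
import Summits.ResolutionOfSingularities.ResolutionOfSingularities.Theorems.WildConesCampaignW46HypersurfacesCharTwoSpine
import Summits.ResolutionOfSingularities.ResolutionOfSingularities.Theorems.WildConesCampaignW46HypersurfacesCharTwoCubeCriterion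
import Summits.ResolutionOfSingularities.ResolutionOfSingularities.Theorems.WildConesCampaignW46HypersurfacesCharTwoNearDichotomy
import Summits.ResolutionOfSingularities.ResolutionOfSingularities.Theorems.WildConesCampaignW46HypersurfacesCharTwoThirdPoint
import Summits.ResolutionOfSingularities.ResolutionOfSingularities.Theorems.WildConesCampaignW46HypersurfacesCharTwoThreeTangentsClosed
import Summits.ResolutionOfSingularities.ResolutionOfSingularities.Theorems.WildConesCampaignW46HypersurfacesCharTwoCensusStatement

/-!
# [OURS · L1 W4.6, rung (ii) at p = 2, every dimension n] PROOFS BY NAME of the corank-two CENSUS predicates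
# (`…HypersurfacesCharTwoCensusStatement.lean`, census rev 1) at `p = 2`, for every `n`

HONEST FRAMING. OURS: each closer instantiates a predicate `CampaignW46Hypersurfaces… (p n)` of the census statement
file at `p = 2` and proves it BY NAME from this seat's gen-6 files `…HypersurfacesCharTwo{NullPolar,CubicPolarization,
FreePoints}.lean` (p542945, p543928, the FreePoints file). Route WildCones' typed point-blow-up dynamics; the polar
matrix of the statements is `CampaignW46.HypersurfacesCharTwo.polarMatrix (ser c)` by `rfl`. NOTHING here is a
statement of the manuscript [Hironaka2017]; no FACT-LIST premise; AI review is weaker than expert review. Cell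
res-hironaka (LADDER-RESOLUTION rung L, D-0089), slot W4.6, seat res-L1-s46-pv-4 (gen 6); host crux `ClassicalRegimes`
(stmt-ResolutionOfSingularities-16884; proved) — helper, `--supports`.

WHAT IS PROVED: `campaignW46Hypersurfaces<X>_two (n) : CampaignW46Hypersurfaces<X> 2 n` for `X ∈ {NullPolarHilbertTwo,
HilbertOneIffNoNullPolar, HilbertTwoIffNullPolarLine, NullPolarUnique, CubicPolarization, CubicValuesHilbertThree,
CorankTwoCountHilbert, HilbertOneCensus, TwoFreeHilbertOne, FreeUnique, HilbertTwoCount, SuccessorDichotomy}` and the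
conjunction `campaignW46HypersurfacesCensus_two_all`.

REV 2 (same seat, gen 6, APPEND-ONLY: the thirteen rev-1 theorems are byte-identical; two imports added): closers of the
five rev-2 predicates `CampaignW46Hypersurfaces{SatelliteSpine, SpineEnd, Caterpillar, CubeCriterion, HilbertTwoExactCount}` from
`…HypersurfacesCharTwo{Spine,CubeCriterion}.lean` (p548115, p549448), and `campaignW46HypersurfacesCensus_two_all_rev2`.

REV 3 (same seat, gen 6, APPEND-ONLY: the nineteen rev-1/rev-2 theorems are byte-identical; one import added): closers of the
two rev-3 predicates `CampaignW46HypersurfacesNearDichotomy`, `CampaignW46FourfoldsOrdTwoCensus` from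
`…HypersurfacesCharTwoNearDichotomy.lean`, and `campaignW46HypersurfacesCensus_two_all_rev3`.

REV 4 (same seat, gen 6, APPEND-ONLY: the twenty-two rev-1/2/3 theorems are byte-identical; one import added): closer of the
rev-4 predicate `CampaignW46HypersurfacesThirdFreePoint` from `…HypersurfacesCharTwoThirdPoint.lean` (p555329).

REV 5 (same seat, gen 6, APPEND-ONLY: the twenty-three rev-1..4 theorems are byte-identical; one import added): closer of the
rev-5 predicate `CampaignW46HypersurfacesThreeTangentsClosed` from `…HypersurfacesCharTwoThreeTangentsClosed.lean` (p557052).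

References: [CasasAlvero2000] §3 (context); [GreuelPfister2026] (context); [Hironaka2017] Th. 16.6 p.84 — role
replaced only, under adjudication.
-/

noncomputable section

-- single-problem summit: the doubled namespace component `ResolutionOfSingularities` is forced
set_option linter.dupNamespace false

open scoped Classical

namespace Summit.ResolutionOfSingularities.ResolutionOfSingularities.Theorems

open CampaignW46.HypersurfacesCharTwo

/-- [OURS · L1 W4.6 rung (ii), every `n`; NOT a statement of the manuscript]
`CampaignW46HypersurfacesNullPolarHilbertTwo 2 n` holds (`hypersurface_two_le_milnorHilbertTwo_of_null_polar`).
[folklore] -/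
theorem campaignW46HypersurfacesNullPolarHilbertTwo_two (n : ℕ) : CampaignW46HypersurfacesNullPolarHilbertTwo 2 n :=
  fun _ _ _ c _ hM he hne hlam hnull => hypersurface_two_le_milnorHilbertTwo_of_null_polar c hM he hne hlam hnull

/-- [OURS · L1 W4.6 rung (ii), every `n`; NOT a statement of the manuscript]
`CampaignW46HypersurfacesHilbertOneIffNoNullPolar 2 n` holds (`hypersurface_milnorHilbertTwo_eq_one_iff_no_null_polar`).
[folklore] -/
theorem campaignW46HypersurfacesHilbertOneIffNoNullPolar_two (n : ℕ) :
    CampaignW46HypersurfacesHilbertOneIffNoNullPolar 2 n :=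
  fun _ _ _ c hM he => hypersurface_milnorHilbertTwo_eq_one_iff_no_null_polar c hM he

/-- [OURS · L1 W4.6 rung (ii), every `n`; NOT a statement of the manuscript]
`CampaignW46HypersurfacesHilbertTwoIffNullPolarLine 2 n` holds
(`hypersurface_milnorHilbertTwo_eq_two_iff_null_polar_line`): with the rev-2 near-locus predicate
`…HilbertThreeIffPolar` this is `h₂ = 1 + dim N`. [folklore] -/
theorem campaignW46HypersurfacesHilbertTwoIffNullPolarLine_two (n : ℕ) :
    CampaignW46HypersurfacesHilbertTwoIffNullPolarLine 2 n :=
  fun _ _ _ c hM he => hypersurface_milnorHilbertTwo_eq_two_iff_null_polar_line c hM he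

/-- [OURS · L1 W4.6 rung (ii), every `n`; NOT a statement of the manuscript]
`CampaignW46HypersurfacesNullPolarUnique 2 n` holds (`hypersurface_null_polar_unique`). [folklore] -/
theorem campaignW46HypersurfacesNullPolarUnique_two (n : ℕ) : CampaignW46HypersurfacesNullPolarUnique 2 n :=
  fun _ _ _ c _ _ hM he hh hne hlam₁ hlam₂ hnull₁ hnull₂ =>
    hypersurface_null_polar_unique c hM he hh hne hlam₁ hlam₂ hnull₁ hnull₂

/-- [OURS · L1 W4.6 rung (ii), every `n`; NOT a statement of the manuscript]
`CampaignW46HypersurfacesCubicPolarization 2 n` holds (`degForm_three_add`). [folklore] -/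
theorem campaignW46HypersurfacesCubicPolarization_two (n : ℕ) : CampaignW46HypersurfacesCubicPolarization 2 n :=
  fun _ _ _ f v v' => degForm_three_add f v v'

/-- [OURS · L1 W4.6 rung (ii), every `n`; NOT a statement of the manuscript]
`CampaignW46HypersurfacesCubicValuesHilbertThree 2 n` holds
(`hypersurface_milnorHilbertTwo_eq_three_of_cubic_values`). [folklore] -/
theorem campaignW46HypersurfacesCubicValuesHilbertThree_two (n : ℕ) :
    CampaignW46HypersurfacesCubicValuesHilbertThree 2 n :=
  fun _ _ _ hκ c hM he hval => hypersurface_milnorHilbertTwo_eq_three_of_cubic_values hκ c hM he hval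

/-- [OURS · L1 W4.6 rung (ii), every `n`, every field of characteristic two; NOT a statement of the manuscript]
`CampaignW46HypersurfacesCorankTwoCountHilbert 2 n` holds: at most three infinitely-near double points at `h₂ ≤ 2`,
no value hypothesis (`hypersurface_nearPoints_le_three_of_milnorHilbertTwo_le_two`). [cite: CasasAlvero2000, §3] -/
theorem campaignW46HypersurfacesCorankTwoCountHilbert_two (n : ℕ) : CampaignW46HypersurfacesCorankTwoCountHilbert 2 n :=
  fun _ _ _ c hM hI he hh => hypersurface_nearPoints_le_three_of_milnorHilbertTwo_le_two c hM hI he hh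

/-- [OURS · L1 W4.6 rung (ii), every `n`, every field of characteristic two; NOT a statement of the manuscript]
`CampaignW46HypersurfacesHilbertOneCensus 2 n` holds: the `D₄` line of the census
(`hypersurface_near_census_of_milnorHilbertTwo_eq_one`). [cite: CasasAlvero2000, §3] -/
theorem campaignW46HypersurfacesHilbertOneCensus_two (n : ℕ) : CampaignW46HypersurfacesHilbertOneCensus 2 n :=
  fun _ _ _ c hM hI he hh => hypersurface_near_census_of_milnorHilbertTwo_eq_one c hM hI he hh

/-- [OURS · L1 W4.6 rung (ii), every `n`; NOT a statement of the manuscript]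
`CampaignW46HypersurfacesTwoFreeHilbertOne 2 n` holds (`hypersurface_two_free_points_milnorHilbertTwo_eq_one`).
[cite: CasasAlvero2000, §3] -/
theorem campaignW46HypersurfacesTwoFreeHilbertOne_two (n : ℕ) : CampaignW46HypersurfacesTwoFreeHilbertOne 2 n :=
  fun _ _ _ c _ _ hM he hne hw₁ hw₂ hnot hc₁ hc₂ hf₁ hf₂ =>
    hypersurface_two_free_points_milnorHilbertTwo_eq_one c hM he hne hw₁ hw₂ hnot hc₁ hc₂ hf₁ hf₂

/-- [OURS · L1 W4.6 rung (ii), every `n`; NOT a statement of the manuscript]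
`CampaignW46HypersurfacesFreeUnique 2 n` holds (`hypersurface_free_successors_proportional`).
[cite: CasasAlvero2000, §3] -/
theorem campaignW46HypersurfacesFreeUnique_two (n : ℕ) : CampaignW46HypersurfacesFreeUnique 2 n :=
  fun _ _ _ c _ _ _ _ hM he hh hM₁ hM₂ he₁ he₂ =>
    hypersurface_free_successors_proportional c hM he hh hM₁ hM₂ he₁ he₂

/-- [OURS · L1 W4.6 rung (ii), every `n`, every field of characteristic two; NOT a statement of the manuscript]
`CampaignW46HypersurfacesHilbertTwoCount 2 n` holds: at most two infinitely-near double points in the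
multiple-tangent class (`hypersurface_nearPoints_le_two_of_milnorHilbertTwo_eq_two`). [cite: CasasAlvero2000, §3] -/
theorem campaignW46HypersurfacesHilbertTwoCount_two (n : ℕ) : CampaignW46HypersurfacesHilbertTwoCount 2 n :=
  fun _ _ _ c hM he hh => hypersurface_nearPoints_le_two_of_milnorHilbertTwo_eq_two c hM he hh

/-- [OURS · L1 W4.6 rung (ii), every `n`, every field of characteristic two; NOT a statement of the manuscript]
`CampaignW46HypersurfacesSuccessorDichotomy 2 n` holds
(`hypersurface_successor_dichotomy_of_milnorHilbertTwo_le_two`). [cite: CasasAlvero2000, §3] -/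
theorem campaignW46HypersurfacesSuccessorDichotomy_two (n : ℕ) : CampaignW46HypersurfacesSuccessorDichotomy 2 n :=
  fun _ _ _ c i τ hM hI he hh hM' => hypersurface_successor_dichotomy_of_milnorHilbertTwo_le_two c hM hI he hh i τ hM'

/-- [OURS · L1 W4.6 rung (ii); census rev 1; NOT a statement of the manuscript] The twelve census predicates at
`p = 2`, every dimension at once. [folklore] -/
theorem campaignW46HypersurfacesCensus_two_all :
    (∀ n, CampaignW46HypersurfacesNullPolarHilbertTwo 2 n) ∧ (∀ n, CampaignW46HypersurfacesHilbertOneIffNoNullPolar 2 n) ∧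
      (∀ n, CampaignW46HypersurfacesHilbertTwoIffNullPolarLine 2 n) ∧ (∀ n, CampaignW46HypersurfacesNullPolarUnique 2 n) ∧
      (∀ n, CampaignW46HypersurfacesCubicPolarization 2 n) ∧ (∀ n, CampaignW46HypersurfacesCubicValuesHilbertThree 2 n) ∧
      (∀ n, CampaignW46HypersurfacesCorankTwoCountHilbert 2 n) ∧ (∀ n, CampaignW46HypersurfacesHilbertOneCensus 2 n) ∧
      (∀ n, CampaignW46HypersurfacesTwoFreeHilbertOne 2 n) ∧ (∀ n, CampaignW46HypersurfacesFreeUnique 2 n) ∧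
      (∀ n, CampaignW46HypersurfacesHilbertTwoCount 2 n) ∧ (∀ n, CampaignW46HypersurfacesSuccessorDichotomy 2 n) :=
  ⟨campaignW46HypersurfacesNullPolarHilbertTwo_two, campaignW46HypersurfacesHilbertOneIffNoNullPolar_two,
    campaignW46HypersurfacesHilbertTwoIffNullPolarLine_two, campaignW46HypersurfacesNullPolarUnique_two,
    campaignW46HypersurfacesCubicPolarization_two, campaignW46HypersurfacesCubicValuesHilbertThree_two,
    campaignW46HypersurfacesCorankTwoCountHilbert_two, campaignW46HypersurfacesHilbertOneCensus_two,
    campaignW46HypersurfacesTwoFreeHilbertOne_two, campaignW46HypersurfacesFreeUnique_two,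
    campaignW46HypersurfacesHilbertTwoCount_two, campaignW46HypersurfacesSuccessorDichotomy_two⟩

/-- [OURS · L1 W4.6 rung (ii), every `n`, perfect field; rev 2; NOT a statement of the manuscript]
`CampaignW46HypersurfacesSatelliteSpine 2 n` holds (`hypersurface_satellite_spine`). [cite: CasasAlvero2000, §3] -/
theorem campaignW46HypersurfacesSatelliteSpine_two (n : ℕ) : CampaignW46HypersurfacesSatelliteSpine 2 n :=
  fun _ _ _ _ c hM hI he hh => hypersurface_satellite_spine c hM hI he hh

/-- [OURS · L1 W4.6 rung (ii), every `n`; rev 2; NOT a statement of the manuscript]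
`CampaignW46HypersurfacesSpineEnd 2 n` holds (`hypersurface_spine_end`). [cite: CasasAlvero2000, §3] -/
theorem campaignW46HypersurfacesSpineEnd_two (n : ℕ) : CampaignW46HypersurfacesSpineEnd 2 n :=
  fun _ _ _ c hM hI he => hypersurface_spine_end c hM hI he

/-- [OURS · L1 W4.6 rung (ii), every `n`, perfect field; rev 2; NOT a statement of the manuscript]
`CampaignW46HypersurfacesCaterpillar 2 n` holds (`hypersurface_caterpillar`). [cite: CasasAlvero2000, §3] -/
theorem campaignW46HypersurfacesCaterpillar_two (n : ℕ) : CampaignW46HypersurfacesCaterpillar 2 n :=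
  fun _ _ _ _ c hM hI he hh => hypersurface_caterpillar c hM hI he hh

/-- [OURS · L1 W4.6 rung (ii), every `n`; rev 2; NOT a statement of the manuscript]
`CampaignW46HypersurfacesCubeCriterion 2 n` holds (`hypersurface_exists_free_iff_satellite_not_null`).
[cite: CasasAlvero2000, §3] -/
theorem campaignW46HypersurfacesCubeCriterion_two (n : ℕ) : CampaignW46HypersurfacesCubeCriterion 2 n :=
  fun _ _ _ c _ hM hI he hh hw₀0 hw₀ hsat =>
    hypersurface_exists_free_iff_satellite_not_null c hM hI he hh hw₀0 hw₀ hsat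

/-- [OURS · L1 W4.6 rung (ii), every `n`, perfect field; rev 2; NOT a statement of the manuscript]
`CampaignW46HypersurfacesHilbertTwoExactCount 2 n` holds (`hypersurface_near_count_exact_of_milnorHilbertTwo_eq_two`).
[cite: CasasAlvero2000, §3] -/
theorem campaignW46HypersurfacesHilbertTwoExactCount_two (n : ℕ) : CampaignW46HypersurfacesHilbertTwoExactCount 2 n :=
  fun _ _ _ _ c hM hI he hh => hypersurface_near_count_exact_of_milnorHilbertTwo_eq_two c hM hI he hh

/-- [OURS · L1 W4.6 rung (ii); census rev 2; NOT a statement of the manuscript] The five rev-2 census predicates at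
`p = 2`, every dimension at once. [folklore] -/
theorem campaignW46HypersurfacesCensus_two_all_rev2 :
    (∀ n, CampaignW46HypersurfacesSatelliteSpine 2 n) ∧ (∀ n, CampaignW46HypersurfacesSpineEnd 2 n) ∧
      (∀ n, CampaignW46HypersurfacesCaterpillar 2 n) ∧ (∀ n, CampaignW46HypersurfacesCubeCriterion 2 n) ∧
      (∀ n, CampaignW46HypersurfacesHilbertTwoExactCount 2 n) :=
  ⟨campaignW46HypersurfacesSatelliteSpine_two, campaignW46HypersurfacesSpineEnd_two,
    campaignW46HypersurfacesCaterpillar_two, campaignW46HypersurfacesCubeCriterion_two,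
    campaignW46HypersurfacesHilbertTwoExactCount_two⟩

/-- [OURS · L1 W4.6 rung (ii), every `n`, every corank, every field of characteristic two; rev 3; NOT a statement of
the manuscript] `CampaignW46HypersurfacesNearDichotomy 2 n` holds (`hypersurface_near_dichotomy`). [cite: CasasAlvero2000, §3] -/
theorem campaignW46HypersurfacesNearDichotomy_two (n : ℕ) : CampaignW46HypersurfacesNearDichotomy 2 n :=
  fun _ _ _ c hM hI => hypersurface_near_dichotomy c hM hI

/-- [OURS · L1 W4.6 rung (ii), `n = 4`, every field of characteristic two; rev 3; NOT a statement of the manuscript]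
`CampaignW46FourfoldsOrdTwoCensus 2` holds (`fourfold_ordTwo_near_census`). [cite: GreuelPfister2026, Thm 3.5 and Cor 3.7] -/
theorem campaignW46FourfoldsOrdTwoCensus_two : CampaignW46FourfoldsOrdTwoCensus 2 :=
  fun _ _ _ c hM hI hO => fourfold_ordTwo_near_census c hM hI hO

/-- [OURS · L1 W4.6 rung (ii); census rev 3; NOT a statement of the manuscript] The two rev-3 census predicates at `p = 2`.
[folklore] -/
theorem campaignW46HypersurfacesCensus_two_all_rev3 :
    (∀ n, CampaignW46HypersurfacesNearDichotomy 2 n) ∧ CampaignW46FourfoldsOrdTwoCensus 2 :=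
  ⟨campaignW46HypersurfacesNearDichotomy_two, campaignW46FourfoldsOrdTwoCensus_two⟩

/-- [OURS · L1 W4.6 rung (ii), every `n`, every field of characteristic two; rev 4; NOT a statement of the manuscript]
`CampaignW46HypersurfacesThirdFreePoint 2 n` holds (`hypersurface_third_free_successor`): two free near points give a third.
[cite: CasasAlvero2000, §3] -/
theorem campaignW46HypersurfacesThirdFreePoint_two (n : ℕ) : CampaignW46HypersurfacesThirdFreePoint 2 n :=
  fun _ _ _ c _ _ _ _ hM hI he hM₁ hM₂ he₁ he₂ hnot =>
    hypersurface_third_free_successor c hM hI he hM₁ hM₂ he₁ he₂ hnot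

/-- [OURS · L1 W4.6 rung (ii), every `n`, algebraically closed field of characteristic two; rev 5; NOT a statement of the
manuscript] `CampaignW46HypersurfacesThreeTangentsClosed 2 n` holds (`hypersurface_three_near_points_of_isAlgClosed`): exactly
three infinitely-near double points in the three-tangents class. [cite: CasasAlvero2000, §3] -/
theorem campaignW46HypersurfacesThreeTangentsClosed_two (n : ℕ) : CampaignW46HypersurfacesThreeTangentsClosed 2 n :=
  fun _ _ _ _ c hM hI he hh => hypersurface_three_near_points_of_isAlgClosed c hM hI he hh

end Summit.ResolutionOfSingularities.ResolutionOfSingularities.Theorems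

end
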